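import Mathlib
import Summits.ValiantsHypothesis.ValiantsHypothesis.Theorems.GrenetZeonTwoDimCoefficientsDualUnipotentWildCoreRung
import Summits.ValiantsHypothesis.ValiantsHypothesis.Theorems.GrenetZeonDualUnipotentThreeHalvesHeavyTopIrreducibleSThreeFamily

/-!
# Crux `GrenetZeon.TwoDimCoefficients` (stmt-ValiantsHypothesis-8062), stub `stub_dualUnipotent`:
# the wild core, part 4 — the dimension lever is CLOSED (its hypothesis shape holds iff the ratio is Gerstenhaber's `1/2`)

Parts 1–3 (✓ `…DualUnipotentWildCore`, ✓ `…WildCoreDim`, ✓ `…WildCoreRung`) located the open point of the stub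
`DualUnipotentBound` (`DualUnipotentRepr n m → n² ≤ C·m`) in an IRREDUCIBLE nilpotent Jordan–Hölder block of the
pencil and typed ONE lever on it: a dimension bound for irreducible nilpotent subspaces `V ⊆ M_s(ℂ)` of the shape

  `(IRR a c e s₁)   ∀ s ≥ s₁, ∀ V irreducible nilpotent, c·dim V ≤ a·s² + e·s`,

which at ratio `a/c < 1/2` would push the unconditional `√2·n` rung to `√(2 + 1/(32c))·n`
(✓ `exists_rung_of_irreducible_dim_bound`, ✓ `hasDim2Repr_rung_of_irreducible_dim_bound`), and which the repair
census of the hands g3–g5 carried as its first open line «R1» (the Mathes–Omladič–Radjavi 1991 §5 question in ratio form)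
with the weaker variant «R1ʹ» (`dim < (1 − δ₀)·C(s,2)` on irreducible spaces).

THIS FILE closes that line from TREE FACTS, with the exact answer.  The 24318-side census family
✓ `HeavyTopIrreducibleSThreeFamily.exists_irreducible_nilpotent_finrank_sThree` (val-idea-29 g7 / crit-7 V37 /
val-htc-eng-2: the orbit cone `S₃(s) = 𝔫_{s−2} ⊕ ℂc ⊕ ℂv`, an IRREDUCIBLE nilpotent subspace of `M_s(ℂ)` of dimension
`C(s−2,2) + 2 = C(s,2) − (2s − 5)` for every `s ≥ 4`) and Gerstenhaber's theorem (✓ `Literature…finrank_le_choose_two`) give: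

* `irreducible_dim_bound_of_le` — `(IRR a c e s₁)` HOLDS whenever `c ≤ 2a` (every `e`, `s₁`), by Gerstenhaber alone;
* `not_irreducible_dim_bound` — `(IRR a c e s₁)` FAILS whenever `2a < c` (every `e`, `s₁`): at `s = k + 4`,
  `k = 30a + 10e + s₁ + 1`, the space `S₃(s)` has `c·dim = c·(C(k+2,2)+2) > a·s² + e·s`;
* ★ `irreducible_dim_bound_iff` — hence `(IRR a c e s₁) ↔ c ≤ 2a`: the hypothesis shape of
  ✓ `sq_bound_of_irreducible_dim_bound` is satisfiable EXACTLY at Gerstenhaber's ratio, where that theorem returns the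
  unconditional `2n² ≤ m² + 6n` (✓ `sq_bound_at_half`); the asymptotic rungs ✓ `exists_rung_of_irreducible_dim_bound` /
  ✓ `hasDim2Repr_rung_of_irreducible_dim_bound` (which need `2a < c`) have an UNSATISFIABLE hypothesis
  (`exists_rung_hypothesis_false`); in MOR's currency, `lim ι(s)/s² = 1/2`;
* ★ `irreducible_deficiency_le` — the only surviving form of the lever, a DEFICIENCY bound
  «`dim V + D(s) ≤ C(s,2)` on irreducible nilpotent `V ⊆ M_s`, `s ≥ s₁`», has `D(s) ≤ 2s − 5` for all `s ≥ max s₁ 4`.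
  Fed to the β-entry point ✓ `sq_add_choose_le_of_irreducible_bound` / ✓ `sq_add_choose_le_wildBlock_finrank`
  (`dim W_{t₀} ≥ C(s₀,2) − (C(m,2) + 2n − n²)`), such a `D` moves the flatness inequality `n² ≤ C(m,2) + 2n` by at most
  `2s₀ − 5 < 2m`, i.e. the threshold `m ≥ √2·n − O(1)` by an additive constant: NO dimension hypothesis on irreducible
  nilpotent spaces can change the constant `√2`.

Consequence for the record (census lines of g3/g4/g5 on stmt-8062 and their cross-posts on stmt-24318): R1 and R1ʹ are
CLOSED NEGATIVELY (no literature seat / numerics seat needed: the counterexamples are in the tree since 2026-08-29);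
what remains for the located open point is per-specific (R2: a property of `per_n` on the big irreducible block beyond
flatness and beyond the Hessian profile, ✓ `not_dualUnipotentBound_of_hessianProfile`) — open-problem grade — and, on
24318, the research statement (c) `LongMassSlowLawInv` (R3).

HONEST FRAMING: a closure of a census line by tree facts, landed `--supports stmt-ValiantsHypothesis-8062 --as helper`;
it proves nothing about the permanent: `stub_dualUnipotent`, the crux `TwoDimCoefficients` (an ASIDE item),
`DualUnipotentThreeHalves` and `VP ≠ VNP` are NOT proved and not moved.

References: M. Gerstenhaber, *On nilalgebras and linear varieties of nilpotent matrices I*, Amer. J. Math. 80 (1958),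
Thm. 1 (via the tree); B. Mathes, M. Omladič, H. Radjavi, *Linear spaces of nilpotent matrices*, Linear Algebra Appl.
149 (1991) 215–225, §5 (the question; their irreducible example has dimension `≈ s²/3`).
-/

-- single-conjunct layout `Summits/ValiantsHypothesis/ValiantsHypothesis`: the duplicated namespace
-- component is mandated by the tree.
set_option linter.dupNamespace false

noncomputable section

namespace Summit.ValiantsHypothesis.ValiantsHypothesis.Cruxes.TwoDimCoefficients.DimTwoCases

open Matrix
open Summit.ValiantsHypothesis.ValiantsHypothesis.Theorems.GrenetZeon.HeavyTopIrreducibleSThreeFamily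
  (exists_irreducible_nilpotent_finrank_sThree exists_irreducible_nilpotent_finrank_choose)
open Literature.NumberTheory.Waring.PolygonalNumberTheorem (two_mul_choose_two_add)
open Literature.LinearAlgebra.Matrix.GerstenhaberNilpotentSubspace (finrank_le_choose_two)

/-! ### §1 The hypothesis shape `(IRR a c e s₁)` holds iff `c ≤ 2a` -/

/-- **At or above Gerstenhaber's ratio the shape holds.**  If `c ≤ 2a` then every nilpotent linear subspace
`V ⊆ M_s(ℂ)` — irreducible or not — satisfies `c·dim V ≤ a·s² + e·s` (`dim V ≤ C(s,2)`, ✓ `finrank_le_choose_two`,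
and `2·C(s,2) + s = s²`). [cite: Gerstenhaber1958, Thm. 1 — via the tree] -/
theorem irreducible_dim_bound_of_le (a c e s₁ : ℕ) (hc : c ≤ 2 * a) :
    ∀ s : ℕ, s₁ ≤ s → ∀ V : Submodule ℂ (Matrix (Fin s) (Fin s) ℂ), (∀ B ∈ V, IsNilpotent B) →
      (∀ U : Submodule ℂ (Fin s → ℂ), (∀ B ∈ V, ∀ x ∈ U, B *ᵥ x ∈ U) → U = ⊥ ∨ U = ⊤) →
      c * Module.finrank ℂ V ≤ a * s ^ 2 + e * s := by
  intro s _ V hV _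
  have hG : Module.finrank ℂ V ≤ s.choose 2 := finrank_le_choose_two s V hV
  have hch : 2 * s.choose 2 + s = s ^ 2 := two_mul_choose_two_add s
  have h1 : c * Module.finrank ℂ V ≤ c * s.choose 2 := Nat.mul_le_mul_left _ hG
  have h2 : c * s.choose 2 ≤ 2 * a * s.choose 2 := Nat.mul_le_mul_right _ hc
  have h3 : 2 * a * s.choose 2 = a * (2 * s.choose 2) := by ring
  have h4 : a * (2 * s.choose 2) ≤ a * s ^ 2 := Nat.mul_le_mul_left _ (by omega)
  calc c * Module.finrank ℂ V ≤ a * s ^ 2 := by omega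
    _ ≤ a * s ^ 2 + e * s := Nat.le_add_right _ _

/-- **Below Gerstenhaber's ratio the shape fails** — for EVERY linear correction `e` and EVERY threshold `s₁`.
Witness: the orbit cone `S₃(s)` of the 24318-side census (✓ `exists_irreducible_nilpotent_finrank_sThree`), an
irreducible nilpotent subspace of `M_{k+4}(ℂ)` of dimension `C(k+2,2) + 2`, at `k = 30a + 10e + s₁ + 1`:
`c·(C(k+2,2)+2) ≥ (2a+1)·(k²+3k+6)/2 > a·(k+4)² + e·(k+4)`.  This refutes census line R1 («irreducible nilpotent
spaces have `dim ≤ (1/2 − ε₀)s²`», any `ε₀ > 0`) and R1ʹ («`dim < (1−δ₀)·C(s,2)`», any `δ₀ > 0`) of the hands g3–g5.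
[folklore; counterexample family: val-idea-29 g7 / crit-7 V37 / val-htc-eng-2, tree theorem] -/
theorem not_irreducible_dim_bound (a c e s₁ : ℕ) (h2a : 2 * a < c) :
    ¬ ∀ s : ℕ, s₁ ≤ s → ∀ V : Submodule ℂ (Matrix (Fin s) (Fin s) ℂ), (∀ B ∈ V, IsNilpotent B) →
      (∀ U : Submodule ℂ (Fin s → ℂ), (∀ B ∈ V, ∀ x ∈ U, B *ᵥ x ∈ U) → U = ⊥ ∨ U = ⊤) →
      c * Module.finrank ℂ V ≤ a * s ^ 2 + e * s := by
  intro hIRR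
  obtain ⟨d, rfl⟩ : ∃ d, c = 2 * a + 1 + d := ⟨c - (2 * a + 1), by omega⟩
  -- the witness size `s = k + 4`
  set k : ℕ := 30 * a + 10 * e + s₁ + 1 with hk
  obtain ⟨V, hd, hnil, hirr⟩ := exists_irreducible_nilpotent_finrank_sThree k
  have h := hIRR (k + 4) (by omega) V hnil hirr
  rw [hd] at h
  -- `2·C(k+2,2) = (k+2)(k+1)`
  have hch : 2 * (k + 2).choose 2 + (k + 2) = (k + 2) ^ 2 := two_mul_choose_two_add (k + 2)
  have hX : 2 * (k + 2).choose 2 = (k + 2) * (k + 1) := by nlinarith [hch]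
  -- clear the binomial coefficient and the slack `d`
  have h2 : (2 * a + 1 + d) * ((k + 2) * (k + 1) + 4) ≤ 2 * (a * (k + 4) ^ 2 + e * (k + 4)) := by
    calc (2 * a + 1 + d) * ((k + 2) * (k + 1) + 4)
        = 2 * ((2 * a + 1 + d) * ((k + 2).choose 2 + 2)) := by rw [← hX]; ring
      _ ≤ 2 * (a * (k + 4) ^ 2 + e * (k + 4)) := Nat.mul_le_mul_left 2 h
  have h3 : (2 * a + 1) * ((k + 2) * (k + 1) + 4) ≤ 2 * (a * (k + 4) ^ 2 + e * (k + 4)) :=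
    le_trans (Nat.mul_le_mul_right _ (Nat.le_add_right _ _)) h2
  -- `k ≥ 30a + 10e + 1`
  have hk1 : 30 * a + 10 * e + 1 ≤ k := by omega
  have hkk : k * (30 * a + 10 * e + 1) ≤ k * k := Nat.mul_le_mul_left k hk1
  have hak : a ≤ a * k := Nat.le_mul_of_pos_right a (by omega)
  have hek : e ≤ e * k := Nat.le_mul_of_pos_right e (by omega)
  nlinarith [h3, hkk, hak, hek]

/-- ★ **Exact answer for the hypothesis shape of ✓ `sq_bound_of_irreducible_dim_bound`.**  For natural parameters
`a c e s₁`: «every irreducible nilpotent subspace `V ⊆ M_s(ℂ)`, `s ≥ s₁`, has `c·dim V ≤ a·s² + e·s`» holds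
IF AND ONLY IF `c ≤ 2a`.  (So the binder is satisfiable exactly at Gerstenhaber's ratio, where the conditional rung is
the unconditional `2n² ≤ m² + 6n`, ✓ `sq_bound_at_half`; in Mathes–Omladič–Radjavi's currency `ι(s)/s² → 1/2`.)
[folklore; Gerstenhaber 1958 + the tree's `S₃` family] -/
theorem irreducible_dim_bound_iff (a c e s₁ : ℕ) :
    (∀ s : ℕ, s₁ ≤ s → ∀ V : Submodule ℂ (Matrix (Fin s) (Fin s) ℂ), (∀ B ∈ V, IsNilpotent B) →
      (∀ U : Submodule ℂ (Fin s → ℂ), (∀ B ∈ V, ∀ x ∈ U, B *ᵥ x ∈ U) → U = ⊥ ∨ U = ⊤) →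
      c * Module.finrank ℂ V ≤ a * s ^ 2 + e * s) ↔ c ≤ 2 * a := by
  constructor
  · intro h
    by_contra hc
    exact not_irreducible_dim_bound a c e s₁ (by omega) h
  · exact irreducible_dim_bound_of_le a c e s₁

/-- **The asymptotic conditional rungs are vacuous.**  The hypothesis of ✓ `exists_rung_of_irreducible_dim_bound`
and of ✓ `hasDim2Repr_rung_of_irreducible_dim_bound` (ratio `2a < c`) is unsatisfiable; those theorems stay true but
carry no information about `per_n`. [folklore] -/
theorem exists_rung_hypothesis_false (a c e s₁ : ℕ) (h2a : 2 * a < c)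
    (hIRR : ∀ s : ℕ, s₁ ≤ s → ∀ V : Submodule ℂ (Matrix (Fin s) (Fin s) ℂ), (∀ B ∈ V, IsNilpotent B) →
      (∀ U : Submodule ℂ (Fin s → ℂ), (∀ B ∈ V, ∀ x ∈ U, B *ᵥ x ∈ U) → U = ⊥ ∨ U = ⊤) →
      c * Module.finrank ℂ V ≤ a * s ^ 2 + e * s) : False :=
  not_irreducible_dim_bound a c e s₁ h2a hIRR

/-! ### §2 The surviving form: deficiency bounds are at most linear -/

/-- ★ **Deficiency ceiling.**  If a function `D` bounds the Gerstenhaber DEFICIENCY of irreducible nilpotent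
subspaces from below — `dim V + D(s) ≤ C(s,2)` for every irreducible nilpotent `V ⊆ M_s(ℂ)`, `s ≥ s₁` — then
`D(s) ≤ 2s − 5` for every `s ≥ max s₁ 4` (the orbit cone `S₃(s)` has deficiency exactly `2s − 5`:
`C(s,2) − (C(s−2,2) + 2) = 2s − 5`).  Fed to ✓ `sq_add_choose_le_wildBlock_finrank` (the wild block of a width-`m`
unipotent-dual representation of `per_n`, `m ≤ 2n`, has `dim ≥ C(s₀,2) − (C(m,2) + 2n − n²)`), the best such `D`
improves `n² ≤ C(m,2) + 2n` by `< 2s₀ ≤ 2m`, i.e. the threshold `m ≳ √2·n` by an additive `O(1)`: the dimension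
lever cannot change the constant `√2`. [folklore; the tree's `S₃` family] -/
theorem irreducible_deficiency_le (D : ℕ → ℕ) (s₁ : ℕ)
    (hD : ∀ s : ℕ, s₁ ≤ s → ∀ V : Submodule ℂ (Matrix (Fin s) (Fin s) ℂ), (∀ B ∈ V, IsNilpotent B) →
      (∀ U : Submodule ℂ (Fin s → ℂ), (∀ B ∈ V, ∀ x ∈ U, B *ᵥ x ∈ U) → U = ⊥ ∨ U = ⊤) →
      Module.finrank ℂ V + D s ≤ s.choose 2)
    (s : ℕ) (hs : s₁ ≤ s) (hs4 : 4 ≤ s) : D s + 5 ≤ 2 * s := by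
  obtain ⟨k, rfl⟩ : ∃ k, s = k + 4 := ⟨s - 4, by omega⟩
  obtain ⟨V, hd, hnil, hirr⟩ := exists_irreducible_nilpotent_finrank_sThree k
  have h := hD (k + 4) hs V hnil hirr
  rw [hd] at h
  have h1 : 2 * (k + 4).choose 2 + (k + 4) = (k + 4) ^ 2 := two_mul_choose_two_add (k + 4)
  have h2 : 2 * (k + 2).choose 2 + (k + 2) = (k + 2) ^ 2 := two_mul_choose_two_add (k + 2)
  nlinarith [h, h1, h2]

/-- **Corollary (the numerics question of the g5 census, answered asymptotically).**  «Are all nilpotent subspaces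
of `M_s(ℂ)` of dimension `≥ (1 − δ₀)·C(s,2)` reducible?» — no, for every `δ₀ > 0` and all large `s`: in integers, for
all `p < q` (ratio `p/q < 1`) and every `s ≥ max 4 (8q)` there is an IRREDUCIBLE nilpotent subspace `V ⊆ M_s(ℂ)` with
`q·dim V ≥ p·C(s,2)`. [folklore; the tree's `S₃` family] -/
theorem exists_irreducible_finrank_ge_ratio (p q s : ℕ) (hpq : p < q) (hs4 : 4 ≤ s) (hs : 8 * q ≤ s) :
    ∃ V : Submodule ℂ (Matrix (Fin s) (Fin s) ℂ), (∀ A ∈ V, IsNilpotent A) ∧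
      (∀ U : Submodule ℂ (Fin s → ℂ), (∀ A ∈ V, ∀ x ∈ U, A *ᵥ x ∈ U) → U = ⊥ ∨ U = ⊤) ∧
      p * s.choose 2 ≤ q * Module.finrank ℂ V := by
  obtain ⟨k, rfl⟩ : ∃ k, s = k + 4 := ⟨s - 4, by omega⟩
  obtain ⟨V, hd, hnil, hirr⟩ := exists_irreducible_nilpotent_finrank_sThree k
  refine ⟨V, hnil, hirr, ?_⟩
  rw [hd]
  obtain ⟨r, rfl⟩ : ∃ r, q = p + 1 + r := ⟨q - (p + 1), by omega⟩
  have h1 : 2 * (k + 4).choose 2 + (k + 4) = (k + 4) ^ 2 := two_mul_choose_two_add (k + 4)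
  have h2 : 2 * (k + 2).choose 2 + (k + 2) = (k + 2) ^ 2 := two_mul_choose_two_add (k + 2)
  -- `C(k+4,2) = C(k+2,2) + 2k + 5`, and `(1 + r)·C(k+2,2) ≥ p·(2k+5) − …` once `k + 4 ≥ 8(p+1+r)`
  have hk : 8 * (p + 1 + r) ≤ k + 4 := hs
  have hC : (k + 4).choose 2 = (k + 2).choose 2 + 2 * k + 5 := by nlinarith [h1, h2]
  rw [hC]
  -- it suffices: p·(2k+5) ≤ (1+r)·(C(k+2,2) + 2), and C(k+2,2) ≥ (k+2)(k+1)/2 ≥ 4(p+1+r)·(k+1)/… ; do it via `2·C = (k+2)(k+1)`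
  have hX : 2 * (k + 2).choose 2 = (k + 2) * (k + 1) := by nlinarith [h2]
  have hk2 : (k + 2) * (8 * (p + 1 + r)) ≤ (k + 2) * (k + 6) := Nat.mul_le_mul_left _ (by omega)
  nlinarith [hX, hk2]

end Summit.ValiantsHypothesis.ValiantsHypothesis.Cruxes.TwoDimCoefficients.DimTwoCases

end
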